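import Literature.Probability.RandomPlanarGeometry.SAWPulledLargeForceExpansionZdSeventhOrder
import Literature.Probability.RandomPlanarGeometry.SAWPulledLargeForceExpansionZdNineStep
import Literature.Probability.RandomPlanarGeometry.SAWPulledLargeForceExpansionZdFourSlackTwoCount
import Literature.Probability.RandomPlanarGeometry.SAWPulledLargeForceExpansionZdTwoSlackCount
import Literature.Probability.RandomPlanarGeometry.SAWPulledLargeForceExpansionZdStaples
import HarnessLib

/-!
# The pulled self-avoiding walk on `ℤ^{d+1}` at large force: the eighth coefficient
# `c^{(d)}_8 = −4d(32d⁶ + 496d⁵ + 1280d⁴ − 484d³ − 432d² + 256d − 101)` in every dimension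

Topic `Literature/Probability/RandomPlanarGeometry` («ZD-EIGHTH»; continues `SAWPulledLargeForceExpansionZdSeventhOrder.lean` one order: the generic
eighth-order algebra `coeff_pow_seven`, `coeff_Pz_comp_seven`, `a_eight`, `e_eight_eq`, and the cost-eight data `N_{8,9}` (`…ZdNineStep`:
`costCoeffZd_eight_nine_add`, the eight-step self-avoiding walks), `N_{8,10}` (`…ZdFourSlackTwoCount`: `FourSlackTwo.costCoeffZd_eight_ten_add`),
`N_{8,11}` (`…ZdTwoSlackCount`: `TwoSlack.costCoeffZd_two_mul_add_two_three_mul_add_two` at `A = 3`), `N_{8,12}` (`…ZdStaples`: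
`costCoeffZd_two_mul_three_mul` at `s = 4`), `N_{8,n} = 0` otherwise).

Printed sources: E. J. Janse van Rensburg, S. G. Whittington, J. Phys. A 46 (2013) 435003, §3.2 Theorem 8 (the expansion to first order; the
method); N. Madras, G. Slade, *The Self-Avoiding Walk* (1993), §1.2, §4.2.  The coefficient `c_8` is not in print in any dimension (lane
«pcv-sawmu»; the `d`-polynomial is CONJECTURE (21) of FINDING-PULLED-LARGE-FORCE, derived from the lane's cost censuses and registered as the
verification row Amendment AX «P-EIGHTH» (scored TRUE 7/7 on two independent enumeration codes before this proof); it is proved here).  The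
counts of `n`-step self-avoiding walks of `ℤ^d` as polynomials in `d` that enter through `N_{7,8}`, `N_{8,9}` are classical print (Fisher–Gaunt 1964;
Clisby–Liang–Slade 2007).  The definition `CostSeries.pW` is this file's tool notion (the seventh binomial moment, sibling of the tree's
`pD … pV`).  No number is taken from print.

## Contents (all PROVED, standard axioms only; no data, no certificates)

* generic (`namespace CostSeries`): `pW c = Σ_n C(n,7) N_{c,n}`, `coeff_pow_seven`, `coeff_Pz_comp_seven`, ★ `a_eight`, ★ `e_eight_eq`;
* on `ℤ^{d+1}`: `costCoeffZd_eight_eleven_add` (`N_{8,11} + 592d³ = 464d⁴ + 120d² + 82d`), `costCoeffZd_eight_twelve` (`= 2d(2d−1)`),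
  `costCoeffZd_eight` (the whole cost-eight column), the moments `pW_one = pV_two = pR_three = 0`, `pQ_four`, `pT_five`, `pH_six`, `pD_seven`,
  `pS_eight`, `aZd_eight = 256d⁸ + 3584d⁷ + 14784d⁶ + 16800d⁵ − 3456d⁴ − 1624d³ + 1000d² − 404d`,
  ★★ `largeForceCoeffZd_at_eight : c^{(d)}_8 = −4d(32d⁶ + 496d⁵ + 1280d⁴ − 484d³ − 432d² + 256d − 101)` (`d = 1, 2, 3`: `−4 188`, `−265 688`,
  `−2 774 964`), `largeForceCoeff_eight_eq : c_8(ℤ²) = −4188`, ★ `exp_pulledBridgeFreeEnergy_eighth_order_zd`.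

Provenance: lane «pcv-sawmu», a-p3 g18 (generic algebra, 2026-08-25) / a-p3 g19 (cost-eight column and assembly, 2026-08-26).
-/

noncomputable section

open Finset
open scoped BigOperators
open Literature.Probability.LatticeModels
open Literature.Probability.RandomPlanarGeometry.SAW

namespace Literature.Probability.RandomPlanarGeometry.SAW.Zd

namespace CostSeries

variable (N : ℕ → ℕ → ℕ)

/-- `pW c = P_c⁽⁷⁾(1)/5040 = Σ_n C(n,7) N_{c,n}`. [cite: JansevanRensburgWhittington2013, §3.2 Theorem 8 (arXiv v4 p. 11)] -/
def pW (c : ℕ) : ℤ := ∑ n ∈ Finset.range (2 * c + 2), (n.choose 7 : ℤ) * N c n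

/-- The coefficient `7` of `p^n` when `p(0) = 1` (partitions of `7` with multinomial multiplicities).
[cite: JansevanRensburgWhittington2013, §3.2 Theorem 8 (arXiv v4 p. 11)] -/
theorem coeff_pow_seven (p : Polynomial ℤ) (h0 : p.coeff 0 = 1) (n : ℕ) :
    (p ^ n).coeff 7 = n * p.coeff 7 +
      (n.choose 2 : ℤ) * (2 * (p.coeff 1 * p.coeff 6) + 2 * (p.coeff 2 * p.coeff 5) + 2 * (p.coeff 3 * p.coeff 4)) +
      (n.choose 3 : ℤ) * (3 * (p.coeff 1 ^ 2 * p.coeff 5) + 6 * (p.coeff 1 * p.coeff 2 * p.coeff 4) + 3 * (p.coeff 1 * p.coeff 3 ^ 2) +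
        3 * (p.coeff 2 ^ 2 * p.coeff 3)) +
      (n.choose 4 : ℤ) * (4 * (p.coeff 1 ^ 3 * p.coeff 4) + 12 * (p.coeff 1 ^ 2 * p.coeff 2 * p.coeff 3) + 4 * (p.coeff 1 * p.coeff 2 ^ 3)) +
      (n.choose 5 : ℤ) * (5 * (p.coeff 1 ^ 4 * p.coeff 3) + 10 * (p.coeff 1 ^ 3 * p.coeff 2 ^ 2)) +
      6 * (n.choose 6 : ℤ) * (p.coeff 1 ^ 5 * p.coeff 2) + (n.choose 7 : ℤ) * p.coeff 1 ^ 7 := by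
  induction n with
  | zero => simp [Polynomial.coeff_one]
  | succ n ih =>
    obtain ⟨i0, i1, i2⟩ := coeff_pow_low p h0 n
    have i3 := coeff_pow_three p h0 n
    have i4 := coeff_pow_four p h0 n
    have i5 := coeff_pow_five p h0 n
    have i6 := coeff_pow_six p h0 n
    rw [pow_succ, Polynomial.coeff_mul, Finset.Nat.sum_antidiagonal_eq_sum_range_succ_mk]
    simp only [Finset.sum_range_succ, Finset.sum_range_zero, Nat.reduceSub, Nat.sub_self, zero_add]
    rw [i0, i1, i2, i3, i4, i5, i6, ih, h0, Nat.choose_succ_succ n 1, Nat.choose_succ_succ n 2, Nat.choose_succ_succ n 3,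
      Nat.choose_succ_succ n 4, Nat.choose_succ_succ n 5, Nat.choose_succ_succ n 6, Nat.choose_one_right]
    push_cast; ring

/-- `[X⁷](P_c ∘ q)` for `q(0) = 1`, in the moments `pD … pW`. [cite: JansevanRensburgWhittington2013, §3.2 Theorem 8 (arXiv v4 p. 11)] -/
theorem coeff_Pz_comp_seven (c : ℕ) (q : Polynomial ℤ) (h0 : q.coeff 0 = 1) :
    ((Pz N c).comp q).coeff 7 = pD N c * q.coeff 7 +
      pH N c * (2 * (q.coeff 1 * q.coeff 6) + 2 * (q.coeff 2 * q.coeff 5) + 2 * (q.coeff 3 * q.coeff 4)) +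
      pT N c * (3 * (q.coeff 1 ^ 2 * q.coeff 5) + 6 * (q.coeff 1 * q.coeff 2 * q.coeff 4) + 3 * (q.coeff 1 * q.coeff 3 ^ 2) +
        3 * (q.coeff 2 ^ 2 * q.coeff 3)) +
      pQ N c * (4 * (q.coeff 1 ^ 3 * q.coeff 4) + 12 * (q.coeff 1 ^ 2 * q.coeff 2 * q.coeff 3) + 4 * (q.coeff 1 * q.coeff 2 ^ 3)) +
      pR N c * (5 * (q.coeff 1 ^ 4 * q.coeff 3) + 10 * (q.coeff 1 ^ 3 * q.coeff 2 ^ 2)) + 6 * pV N c * (q.coeff 1 ^ 5 * q.coeff 2) +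
      pW N c * q.coeff 1 ^ 7 := by
  have hV : 6 * pV N c * (q.coeff 1 ^ 5 * q.coeff 2) =
      ∑ n ∈ Finset.range (2 * c + 2), 6 * (n.choose 6 : ℤ) * N c n * (q.coeff 1 ^ 5 * q.coeff 2) := by
    rw [pV, Finset.mul_sum, Finset.sum_mul]
    refine Finset.sum_congr rfl fun n _ => ?_
    ring
  rw [Pz_comp_eq, Polynomial.finsetSum_coeff, pD, pH, pT, pQ, pR, pW, hV, Finset.sum_mul, Finset.sum_mul, Finset.sum_mul, Finset.sum_mul,
    Finset.sum_mul, Finset.sum_mul, ← Finset.sum_add_distrib, ← Finset.sum_add_distrib, ← Finset.sum_add_distrib, ← Finset.sum_add_distrib,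
    ← Finset.sum_add_distrib, ← Finset.sum_add_distrib]
  refine Finset.sum_congr rfl fun n _ => ?_
  rw [Polynomial.coeff_C_mul, coeff_pow_seven q h0 n]
  ring

/-- ★ `a_8` in the moments. [cite: JansevanRensburgWhittington2013, §3.2 Theorem 8 (arXiv v4 p. 11)] -/
theorem a_eight : a N 8 =
    -((pD N 1 * a N 7 + pH N 1 * (2 * (a N 1 * a N 6) + 2 * (a N 2 * a N 5) + 2 * (a N 3 * a N 4)) +
        pT N 1 * (3 * (a N 1 ^ 2 * a N 5) + 6 * (a N 1 * a N 2 * a N 4) + 3 * (a N 1 * a N 3 ^ 2) + 3 * (a N 2 ^ 2 * a N 3)) +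
        pQ N 1 * (4 * (a N 1 ^ 3 * a N 4) + 12 * (a N 1 ^ 2 * a N 2 * a N 3) + 4 * (a N 1 * a N 2 ^ 3)) +
        pR N 1 * (5 * (a N 1 ^ 4 * a N 3) + 10 * (a N 1 ^ 3 * a N 2 ^ 2)) + 6 * pV N 1 * (a N 1 ^ 5 * a N 2) + pW N 1 * a N 1 ^ 7)
      + (pD N 2 * a N 6 + pH N 2 * (2 * (a N 1 * a N 5) + 2 * (a N 2 * a N 4) + a N 3 ^ 2) +
        pT N 2 * (3 * (a N 1 ^ 2 * a N 4) + 6 * (a N 1 * a N 2 * a N 3) + a N 2 ^ 3) +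
        pQ N 2 * (4 * (a N 1 ^ 3 * a N 3) + 6 * (a N 1 ^ 2 * a N 2 ^ 2)) + 5 * pR N 2 * (a N 1 ^ 4 * a N 2) + pV N 2 * a N 1 ^ 6)
      + (pD N 3 * a N 5 + pH N 3 * (2 * (a N 1 * a N 4) + 2 * (a N 2 * a N 3)) +
        pT N 3 * (3 * (a N 1 ^ 2 * a N 3) + 3 * (a N 1 * a N 2 ^ 2)) + 4 * pQ N 3 * (a N 1 ^ 3 * a N 2) + pR N 3 * a N 1 ^ 5)
      + (pD N 4 * a N 4 + pH N 4 * (2 * (a N 1 * a N 3) + a N 2 ^ 2) + 3 * pT N 4 * (a N 1 ^ 2 * a N 2) + pQ N 4 * a N 1 ^ 4)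
      + (pD N 5 * a N 3 + 2 * pH N 5 * (a N 1 * a N 2) + pT N 5 * a N 1 ^ 3) + (pD N 6 * a N 2 + pH N 6 * a N 1 ^ 2)
      + pD N 7 * a N 1 + pS N 8) := by
  have h0 : (A N 7).coeff 0 = 1 := coeff_A_zero_eq_one N 7
  rw [a_succ]
  simp only [Finset.sum_range_succ, Finset.sum_range_zero, Nat.reduceAdd, Nat.reduceSub, Nat.sub_self, zero_add]
  rw [coeff_Pz_comp_seven N 1 _ h0, coeff_Pz_comp_six N 2 _ h0, coeff_Pz_comp_five N 3 _ h0, coeff_Pz_comp_four N 4 _ h0,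
    coeff_Pz_comp_three N 5 _ h0, coeff_Pz_comp_two N 6 _ h0, coeff_Pz_comp_one N 7 _ h0, coeff_Pz_comp_zero N 8 _ h0,
    coeff_A_eq_a N (show 7 ≤ 7 from le_rfl), coeff_A_eq_a N (show 6 ≤ 7 by norm_num), coeff_A_eq_a N (show 5 ≤ 7 by norm_num),
    coeff_A_eq_a N (show 4 ≤ 7 by norm_num), coeff_A_eq_a N (show 3 ≤ 7 by norm_num), coeff_A_eq_a N (show 2 ≤ 7 by norm_num),
    coeff_A_eq_a N (show 1 ≤ 7 by norm_num)]

/-- ★ `e_8 = −(a_1 e_7 + ⋯ + a_7 e_1 + a_8)`. [cite: JansevanRensburgWhittington2013, §3.2 Theorem 8 (arXiv v4 p. 11)] -/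
theorem e_eight_eq : e N 8 =
    -(a N 1 * e N 7 + a N 2 * e N 6 + a N 3 * e N 5 + a N 4 * e N 4 + a N 5 * e N 3 + a N 6 * e N 2 + a N 7 * e N 1 + a N 8) := by
  have h := sum_antidiagonal_a_mul_e N (k := 8) (by norm_num)
  rw [Finset.Nat.sum_antidiagonal_eq_sum_range_succ_mk] at h
  simp only [Finset.sum_range_succ, Finset.sum_range_zero, Nat.reduceSub, Nat.sub_self, a_zero, e_zero, zero_add, one_mul,
    mul_one] at h
  linear_combination h

end CostSeries

/-! ### The cost-eight column on `ℤ^{d+1}` -/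

/-- `N_{8,11} + 592d³ = 464d⁴ + 120d² + 82d` (the two-slack layer at span three: `13α + 8β + 3κ + 5γ`). [cite: MadrasSlade1993, §4.2, remark after Theorem 4.2.4 (p. 94)] -/
theorem costCoeffZd_eight_eleven_add (d : ℕ) : costCoeffZd d 8 11 + 592 * d ^ 3 = 464 * d ^ 4 + 120 * d ^ 2 + 82 * d := by
  have h := TwoSlack.costCoeffZd_two_mul_add_two_three_mul_add_two d (A := 3) (by norm_num)
  norm_num at h
  rw [h]
  rcases d with _ | c
  · simp
  · have e1 : 2 * (c + 1) - 1 = 2 * c + 1 := by omega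
    have e2 : 2 * (c + 1) - 2 = 2 * c := by omega
    rw [e1, e2]
    have hle1 : 2 * (c + 1) * (2 * c) ≤ 2 * (c + 1) * (2 * c + 1) ^ 3 :=
      Nat.mul_le_mul_left _ (le_trans (Nat.le_succ _) (Nat.le_self_pow (by norm_num) _))
    zify [hle1]
    ring

/-- `N_{8,11} = 464d⁴ + 120d² + 82d − 592d³`. [cite: MadrasSlade1993, §4.2, remark after Theorem 4.2.4 (p. 94)] -/
theorem costCoeffZd_eight_eleven (d : ℕ) : costCoeffZd d 8 11 = 464 * d ^ 4 + 120 * d ^ 2 + 82 * d - 592 * d ^ 3 := by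
  have h := costCoeffZd_eight_eleven_add d
  omega

/-- `N_{8,12} = 2d(2d−1)` (the staples of span four). [cite: MadrasSlade1993, §4.2, remark after Theorem 4.2.4 (p. 94)] -/
theorem costCoeffZd_eight_twelve (d : ℕ) : costCoeffZd d 8 12 = 2 * d * (2 * d - 1) := by
  simpa using costCoeffZd_two_mul_three_mul d 4 (by norm_num)

/-- ★ **`N_{8,n}`** on `ℤ^{d+1}`: the eight-step self-avoiding walks of `ℤ^d` at `n = 9`, the four-slack layer at `n = 10`, the two-slack layer at
`n = 11`, the staples at `n = 12`, zero otherwise. [cite: MadrasSlade1993, §4.2, remark after Theorem 4.2.4 (p. 94)] -/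
theorem costCoeffZd_eight (d n : ℕ) : costCoeffZd d 8 n =
    if n = 9 then 256 * d ^ 8 + 1024 * d ^ 6 + 320 * d ^ 4 + 424 * d ^ 3 + 1414 * d - 896 * d ^ 7 - 416 * d ^ 5 - 2124 * d ^ 2
    else if n = 10 then 2240 * d ^ 6 + 2016 * d ^ 4 + 1056 * d ^ 3 + 520 * d ^ 2 - 4640 * d ^ 5 - 1090 * d
    else if n = 11 then 464 * d ^ 4 + 120 * d ^ 2 + 82 * d - 592 * d ^ 3
    else if n = 12 then 2 * d * (2 * d - 1) else 0 := by
  by_cases h9 : n = 9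
  · subst h9; rw [if_pos rfl, WordTypes.costCoeffZd_eight_nine]
  rw [if_neg h9]
  by_cases h10 : n = 10
  · subst h10; rw [if_pos rfl, FourSlackTwo.costCoeffZd_eight_ten]
  rw [if_neg h10]
  by_cases h11 : n = 11
  · subst h11; rw [if_pos rfl, costCoeffZd_eight_eleven]
  rw [if_neg h11]
  by_cases h12 : n = 12
  · subst h12; rw [if_pos rfl, costCoeffZd_eight_twelve]
  rw [if_neg h12]
  rcases Nat.lt_or_ge n 9 with h | h
  · exact costCoeffZd_eq_zero_of_le (by omega)
  · exact costCoeffZd_eq_zero_of_three_span (by omega) (by omega)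

/-! ### The moments of the cost data up to cost eight and `c^{(d)}_8` -/

/-- `pW₁ = 0`. [cite: JansevanRensburgWhittington2013, §3.2 Theorem 8 (arXiv v4 p. 11)] -/
theorem pW_one (d : ℕ) : CostSeries.pW (costCoeffZd d) 1 = 0 := by
  rw [CostSeries.pW, show 2 * 1 + 2 = 4 from rfl]
  simp [Finset.sum_range_succ, Nat.choose]

/-- `pV₂ = 0`. [cite: JansevanRensburgWhittington2013, §3.2 Theorem 8 (arXiv v4 p. 11)] -/
theorem pV_two (d : ℕ) : CostSeries.pV (costCoeffZd d) 2 = 0 := by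
  rw [CostSeries.pV, show 2 * 2 + 2 = 6 from rfl]
  simp [Finset.sum_range_succ, Nat.choose]

/-- `pR₃ = 0`. [cite: JansevanRensburgWhittington2013, §3.2 Theorem 8 (arXiv v4 p. 11)] -/
theorem pR_three (d : ℕ) : CostSeries.pR (costCoeffZd d) 3 = 0 := by
  rw [CostSeries.pR, show 2 * 3 + 2 = 8 from rfl]
  simp only [Finset.sum_range_succ, Finset.sum_range_zero,
    costCoeffZd_eq_zero_of_le (show 0 ≤ 3 by norm_num), costCoeffZd_eq_zero_of_le (show 1 ≤ 3 by norm_num),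
    costCoeffZd_eq_zero_of_le (show 2 ≤ 3 by norm_num), costCoeffZd_eq_zero_of_le (show 3 ≤ 3 from le_rfl),
    costCoeffZd_eq_zero_of_three_span (show 3 + 2 ≤ 5 by norm_num) (show 3 * 3 < 2 * 5 by norm_num),
    costCoeffZd_eq_zero_of_three_span (show 3 + 2 ≤ 6 by norm_num) (show 3 * 3 < 2 * 6 by norm_num),
    costCoeffZd_eq_zero_of_three_span (show 3 + 2 ≤ 7 by norm_num) (show 3 * 3 < 2 * 7 by norm_num), Nat.choose]
  simp

/-- `pQ₄ = 5 N_{4,5} + 15 N_{4,6} = 80d⁴ − 120d³ + 100d² − 20d`. [cite: JansevanRensburgWhittington2013, §3.2 Theorem 8 (arXiv v4 p. 11)] -/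
theorem pQ_four (d : ℕ) : CostSeries.pQ (costCoeffZd d) 4 = 80 * d ^ 4 - 120 * d ^ 3 + 100 * d ^ 2 - 20 * d := by
  have h45 := costCoeffZd_four_five_add d
  rw [CostSeries.pQ, show 2 * 4 + 2 = 10 from rfl]
  simp only [Finset.sum_range_succ, Finset.sum_range_zero, costCoeffZd_four_six, costCoeffZd_four_seven,
    costCoeffZd_eq_zero_of_le (show 0 ≤ 4 by norm_num),
    costCoeffZd_eq_zero_of_le (show 1 ≤ 4 by norm_num),
    costCoeffZd_eq_zero_of_le (show 2 ≤ 4 by norm_num),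
    costCoeffZd_eq_zero_of_le (show 3 ≤ 4 by norm_num),
    costCoeffZd_eq_zero_of_le (show 4 ≤ 4 from le_rfl),
    costCoeffZd_eq_zero_of_lt (show 3 * 4 + 2 < 2 * 8 by norm_num), costCoeffZd_eq_zero_of_lt (show 3 * 4 + 2 < 2 * 9 by norm_num),
    Nat.choose]
  rcases Nat.eq_zero_or_pos d with rfl | hd
  · simp at h45 ⊢
    have : costCoeffZd 0 4 5 = 0 := by simpa using h45
    simp [this]
  · obtain ⟨e, rfl⟩ : ∃ e, d = e + 1 := ⟨d - 1, by omega⟩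
    simp only [show 2 * (e + 1) - 1 = 2 * e + 1 by omega, show 2 * (e + 1) - 2 = 2 * e by omega] at h45 ⊢
    have h45' : (costCoeffZd (e + 1) 4 5 : ℤ) = 2 * (e + 1) * (2 * e + 1) ^ 3 - 2 * (e + 1) * (2 * e) := by
      have := congrArg (fun m : ℕ => (m : ℤ)) h45
      push_cast at this
      linarith
    push_cast
    rw [h45']
    ring

/-- `pT₅ = 20 N_{5,6} + 35 N_{5,7} = 640d⁵ − 1280d⁴ + 1760d³ − 880d² + 80d`. [cite: JansevanRensburgWhittington2013, §3.2 Theorem 8 (arXiv v4 p. 11)] -/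
theorem pT_five (d : ℕ) : CostSeries.pT (costCoeffZd d) 5 = 640 * d ^ 5 - 1280 * d ^ 4 + 1760 * d ^ 3 - 880 * d ^ 2 + 80 * d := by
  have h56 := costCoeffZd_five_six_add d
  rw [CostSeries.pT, show 2 * 5 + 2 = 12 from rfl]
  simp only [Finset.sum_range_succ, Finset.sum_range_zero, costCoeffZd_five_seven,
    costCoeffZd_eq_zero_of_le (show 0 ≤ 5 by norm_num),
    costCoeffZd_eq_zero_of_le (show 1 ≤ 5 by norm_num),
    costCoeffZd_eq_zero_of_le (show 2 ≤ 5 by norm_num),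
    costCoeffZd_eq_zero_of_le (show 3 ≤ 5 by norm_num),
    costCoeffZd_eq_zero_of_le (show 4 ≤ 5 by norm_num),
    costCoeffZd_eq_zero_of_le (show 5 ≤ 5 from le_rfl),
    costCoeffZd_eq_zero_of_three_span (show 5 + 2 ≤ 8 by norm_num) (show 3 * 5 < 2 * 8 by norm_num),
    costCoeffZd_eq_zero_of_three_span (show 5 + 2 ≤ 9 by norm_num) (show 3 * 5 < 2 * 9 by norm_num),
    costCoeffZd_eq_zero_of_three_span (show 5 + 2 ≤ 10 by norm_num) (show 3 * 5 < 2 * 10 by norm_num),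
    costCoeffZd_eq_zero_of_three_span (show 5 + 2 ≤ 11 by norm_num) (show 3 * 5 < 2 * 11 by norm_num)]
  rcases Nat.eq_zero_or_pos d with rfl | hd
  · simp at h56 ⊢
    have : costCoeffZd 0 5 6 = 0 := by simpa using h56
    simp [this]
  · obtain ⟨e, rfl⟩ : ∃ e, d = e + 1 := ⟨d - 1, by omega⟩
    simp only [show 2 * (e + 1) - 1 = 2 * e + 1 by omega, show 2 * (e + 1) - 2 = 2 * e by omega,
      show 4 * (e + 1) - 3 = 4 * e + 1 by omega] at h56 ⊢
    have h56' : (costCoeffZd (e + 1) 5 6 : ℤ) = 2 * (e + 1) * (2 * e + 1) ^ 4 - 2 * (e + 1) * (2 * e) * (4 * e + 1) := by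
      have := congrArg (fun m : ℕ => (m : ℤ)) h56
      push_cast at this
      linarith
    simp only [Nat.choose]
    push_cast
    rw [h56']
    ring

/-- `pH₆ = 21 N_{6,7} + 28 N_{6,8} + 36 N_{6,9} = 1344d⁶ − 3360d⁵ + 6832d⁴ − 6048d³ + 2132d² − 114d`. [cite: JansevanRensburgWhittington2013, §3.2 Theorem 8 (arXiv v4 p. 11)] -/
theorem pH_six (d : ℕ) :
    CostSeries.pH (costCoeffZd d) 6 = 1344 * d ^ 6 - 3360 * d ^ 5 + 6832 * d ^ 4 - 6048 * d ^ 3 + 2132 * d ^ 2 - 114 * d := by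
  have h67 := costCoeffZd_six_seven_add' d
  have h68 := costCoeffZd_six_eight_add d
  have h69 := costCoeffZd_six_nine d
  rw [CostSeries.pH, show 2 * 6 + 2 = 14 from rfl]
  simp only [Finset.sum_range_succ, Finset.sum_range_zero,
    costCoeffZd_eq_zero_of_le (show 0 ≤ 6 by norm_num),
    costCoeffZd_eq_zero_of_le (show 1 ≤ 6 by norm_num),
    costCoeffZd_eq_zero_of_le (show 2 ≤ 6 by norm_num),
    costCoeffZd_eq_zero_of_le (show 3 ≤ 6 by norm_num),
    costCoeffZd_eq_zero_of_le (show 4 ≤ 6 by norm_num),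
    costCoeffZd_eq_zero_of_le (show 5 ≤ 6 by norm_num),
    costCoeffZd_eq_zero_of_le (show 6 ≤ 6 from le_rfl),
    costCoeffZd_eq_zero_of_three_span (show 6 + 2 ≤ 10 by norm_num) (show 3 * 6 < 2 * 10 by norm_num),
    costCoeffZd_eq_zero_of_three_span (show 6 + 2 ≤ 11 by norm_num) (show 3 * 6 < 2 * 11 by norm_num),
    costCoeffZd_eq_zero_of_three_span (show 6 + 2 ≤ 12 by norm_num) (show 3 * 6 < 2 * 12 by norm_num),
    costCoeffZd_eq_zero_of_three_span (show 6 + 2 ≤ 13 by norm_num) (show 3 * 6 < 2 * 13 by norm_num)]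
  have h67' : (costCoeffZd d 6 7 : ℤ) = 64 * d ^ 6 + 112 * d ^ 4 + 20 * d ^ 2 - 160 * d ^ 5 - 34 * d := by
    have := congrArg (fun m : ℕ => (m : ℤ)) h67
    push_cast at this
    linarith
  have h68' : (costCoeffZd d 6 8 : ℤ) = 160 * d ^ 4 + 56 * d ^ 2 + 24 * d - 216 * d ^ 3 := by
    have := congrArg (fun m : ℕ => (m : ℤ)) h68
    push_cast at this
    linarith
  rcases Nat.eq_zero_or_pos d with rfl | hd
  · have h69z : (costCoeffZd 0 6 9 : ℤ) = 0 := by rw [h69]; simp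
    simp only [Nat.choose]
    norm_num at h67' h68' ⊢
    linarith
  · obtain ⟨e, rfl⟩ : ∃ e, d = e + 1 := ⟨d - 1, by omega⟩
    simp only [show 2 * (e + 1) - 1 = 2 * e + 1 by omega] at h69
    simp only [Nat.choose]
    push_cast at h67' h68' ⊢
    rw [h67', h68', h69]
    push_cast
    ring

/-- `pD₇ = 8 N_{7,8} + 9 N_{7,9} + 10 N_{7,10} = 1024d⁷ − 3072d⁶ + 8576d⁵ − 10432d⁴ + 4976d³ − 152d² − 296d`. [cite: JansevanRensburgWhittington2013, §3.2 Theorem 8 (arXiv v4 p. 11)] -/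
theorem pD_seven (d : ℕ) :
    CostSeries.pD (costCoeffZd d) 7 = 1024 * d ^ 7 - 3072 * d ^ 6 + 8576 * d ^ 5 - 10432 * d ^ 4 + 4976 * d ^ 3 - 152 * d ^ 2 - 296 * d := by
  have h78 := costCoeffZd_seven_eight_add' d
  have h79 := ThreeSlackTwo.costCoeffZd_seven_nine_add d
  have h710 := costCoeffZd_seven_ten d
  rw [CostSeries.pD, show 2 * 7 + 2 = 16 from rfl]
  simp only [Finset.sum_range_succ, Finset.sum_range_zero,
    costCoeffZd_eq_zero_of_le (show 0 ≤ 7 by norm_num),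
    costCoeffZd_eq_zero_of_le (show 1 ≤ 7 by norm_num),
    costCoeffZd_eq_zero_of_le (show 2 ≤ 7 by norm_num),
    costCoeffZd_eq_zero_of_le (show 3 ≤ 7 by norm_num),
    costCoeffZd_eq_zero_of_le (show 4 ≤ 7 by norm_num),
    costCoeffZd_eq_zero_of_le (show 5 ≤ 7 by norm_num),
    costCoeffZd_eq_zero_of_le (show 6 ≤ 7 by norm_num),
    costCoeffZd_eq_zero_of_le (show 7 ≤ 7 from le_rfl),
    costCoeffZd_eq_zero_of_three_span (show 7 + 2 ≤ 11 by norm_num) (show 3 * 7 < 2 * 11 by norm_num),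
    costCoeffZd_eq_zero_of_three_span (show 7 + 2 ≤ 12 by norm_num) (show 3 * 7 < 2 * 12 by norm_num),
    costCoeffZd_eq_zero_of_three_span (show 7 + 2 ≤ 13 by norm_num) (show 3 * 7 < 2 * 13 by norm_num),
    costCoeffZd_eq_zero_of_three_span (show 7 + 2 ≤ 14 by norm_num) (show 3 * 7 < 2 * 14 by norm_num),
    costCoeffZd_eq_zero_of_three_span (show 7 + 2 ≤ 15 by norm_num) (show 3 * 7 < 2 * 15 by norm_num)]
  have h78' : (costCoeffZd d 7 8 : ℤ) = 128 * d ^ 7 + 352 * d ^ 5 + 192 * d ^ 3 + 166 * d - 384 * d ^ 6 - 80 * d ^ 4 - 372 * d ^ 2 := by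
    have := congrArg (fun m : ℕ => (m : ℤ)) h78
    push_cast at this
    linarith
  have h79' : (costCoeffZd d 7 9 : ℤ) = 640 * d ^ 5 + 320 * d ^ 3 + 376 * d ^ 2 - 1088 * d ^ 4 - 196 * d := by
    have := congrArg (fun m : ℕ => (m : ℤ)) h79
    push_cast at this
    linarith
  rcases Nat.eq_zero_or_pos d with rfl | hd
  · norm_num at h710
    push_cast at h78' h79' ⊢
    rw [h78', h79', h710]
    norm_num
  · obtain ⟨e, rfl⟩ : ∃ e, d = e + 1 := ⟨d - 1, by omega⟩
    simp only [show 2 * (e + 1) - 1 = 2 * e + 1 by omega] at h710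
    push_cast at h78' h79' ⊢
    rw [h78', h79', h710]
    push_cast
    ring

/-- ★ `pS₈ = N_{8,9} + N_{8,10} + N_{8,11} + N_{8,12} = 256d⁸ − 896d⁷ + 3264d⁶ − 5056d⁵ + 2800d⁴ + 888d³ − 1480d² + 404d`. [cite: JansevanRensburgWhittington2013, §3.2 Theorem 8 (arXiv v4 p. 11)] -/
theorem pS_eight (d : ℕ) : CostSeries.pS (costCoeffZd d) 8 =
    256 * d ^ 8 - 896 * d ^ 7 + 3264 * d ^ 6 - 5056 * d ^ 5 + 2800 * d ^ 4 + 888 * d ^ 3 - 1480 * d ^ 2 + 404 * d := by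
  have h89 := WordTypes.costCoeffZd_eight_nine_add d
  have h810 := FourSlackTwo.costCoeffZd_eight_ten_add d
  have h811 := costCoeffZd_eight_eleven_add d
  have h812 := costCoeffZd_eight_twelve d
  rw [CostSeries.pS, show 2 * 8 + 2 = 18 from rfl]
  simp only [Finset.sum_range_succ, Finset.sum_range_zero,
    costCoeffZd_eq_zero_of_le (show 0 ≤ 8 by norm_num),
    costCoeffZd_eq_zero_of_le (show 1 ≤ 8 by norm_num),
    costCoeffZd_eq_zero_of_le (show 2 ≤ 8 by norm_num),
    costCoeffZd_eq_zero_of_le (show 3 ≤ 8 by norm_num),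
    costCoeffZd_eq_zero_of_le (show 4 ≤ 8 by norm_num),
    costCoeffZd_eq_zero_of_le (show 5 ≤ 8 by norm_num),
    costCoeffZd_eq_zero_of_le (show 6 ≤ 8 by norm_num),
    costCoeffZd_eq_zero_of_le (show 7 ≤ 8 by norm_num),
    costCoeffZd_eq_zero_of_le (show 8 ≤ 8 from le_rfl),
    costCoeffZd_eq_zero_of_three_span (show 8 + 2 ≤ 13 by norm_num) (show 3 * 8 < 2 * 13 by norm_num),
    costCoeffZd_eq_zero_of_three_span (show 8 + 2 ≤ 14 by norm_num) (show 3 * 8 < 2 * 14 by norm_num),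
    costCoeffZd_eq_zero_of_three_span (show 8 + 2 ≤ 15 by norm_num) (show 3 * 8 < 2 * 15 by norm_num),
    costCoeffZd_eq_zero_of_three_span (show 8 + 2 ≤ 16 by norm_num) (show 3 * 8 < 2 * 16 by norm_num),
    costCoeffZd_eq_zero_of_three_span (show 8 + 2 ≤ 17 by norm_num) (show 3 * 8 < 2 * 17 by norm_num)]
  have h89' : (costCoeffZd d 8 9 : ℤ) = 256 * d ^ 8 + 1024 * d ^ 6 + 320 * d ^ 4 + 424 * d ^ 3 + 1414 * d - 896 * d ^ 7 - 416 * d ^ 5 -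
      2124 * d ^ 2 := by
    have := congrArg (fun m : ℕ => (m : ℤ)) h89
    push_cast at this
    linarith
  have h810' : (costCoeffZd d 8 10 : ℤ) = 2240 * d ^ 6 + 2016 * d ^ 4 + 1056 * d ^ 3 + 520 * d ^ 2 - 4640 * d ^ 5 - 1090 * d := by
    have := congrArg (fun m : ℕ => (m : ℤ)) h810
    push_cast at this
    linarith
  have h811' : (costCoeffZd d 8 11 : ℤ) = 464 * d ^ 4 + 120 * d ^ 2 + 82 * d - 592 * d ^ 3 := by
    have := congrArg (fun m : ℕ => (m : ℤ)) h811
    push_cast at this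
    linarith
  rcases Nat.eq_zero_or_pos d with rfl | hd
  · norm_num at h812
    push_cast at h89' h810' h811' ⊢
    rw [h89', h810', h811', h812]
    norm_num
  · obtain ⟨e, rfl⟩ : ∃ e, d = e + 1 := ⟨d - 1, by omega⟩
    simp only [show 2 * (e + 1) - 1 = 2 * e + 1 by omega] at h812
    push_cast at h89' h810' h811' ⊢
    rw [h89', h810', h811', h812]
    push_cast
    ring

/-- `a₈ = 256d⁸ + 3584d⁷ + 14784d⁶ + 16800d⁵ − 3456d⁴ − 1624d³ + 1000d² − 404d` on `ℤ^{d+1}`. [cite: JansevanRensburgWhittington2013, §3.2 Theorem 8 (arXiv v4 p. 11)] -/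
theorem aZd_eight (d : ℕ) : CostSeries.a (costCoeffZd d) 8 =
    256 * d ^ 8 + 3584 * d ^ 7 + 14784 * d ^ 6 + 16800 * d ^ 5 - 3456 * d ^ 4 - 1624 * d ^ 3 + 1000 * d ^ 2 - 404 * d := by
  rw [CostSeries.a_eight, aZd_one, aZd_two, aZd_three, aZd_four, aZd_five, aZd_six, aZd_seven, pD_one, pH_one, pT_one, pQ_one, pR_one,
    pV_one, pW_one, pD_two, pH_two, pT_two, pQ_two, pR_two, pV_two, pD_three, pH_three, pT_three, pQ_three, pR_three, pD_four, pH_four,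
    pT_four, pQ_four, pD_five, pH_five, pT_five, pD_six, pH_six, pD_seven, pS_eight]
  push_cast; ring

/-- ★★ **THE EIGHTH COEFFICIENT: `c^{(d)}_8 = −4d(32d⁶ + 496d⁵ + 1280d⁴ − 484d³ − 432d² + 256d − 101)`** on `ℤ^{d+1}`, every dimension
(`d = 1, 2, 3`: `−4 188`, `−265 688`, `−2 774 964`) — CONJECTURE (21) / Amendment AX of the lane, now a theorem. [cite: JansevanRensburgWhittington2013, §3.2 Theorem 8 (arXiv v4 p. 11)] -/
theorem largeForceCoeffZd_at_eight (d : ℕ) :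
    largeForceCoeffZd d 8 = -(4 * d * (32 * d ^ 6 + 496 * d ^ 5 + 1280 * d ^ 4 - 484 * d ^ 3 - 432 * d ^ 2 + 256 * d - 101)) := by
  have e1 : CostSeries.e (costCoeffZd d) 1 = 2 * d := largeForceCoeffZd_at_one d
  have e2 : CostSeries.e (costCoeffZd d) 2 = -(2 * (d : ℤ)) := largeForceCoeffZd_at_two d
  have e3 : CostSeries.e (costCoeffZd d) 3 = 2 * d * (2 * d + 1) := largeForceCoeffZd_at_three d
  have e4 : CostSeries.e (costCoeffZd d) 4 = -(4 * (d : ℤ) ^ 2 * (2 * d + 3)) := largeForceCoeffZd_at_four d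
  have e5 : CostSeries.e (costCoeffZd d) 5 = 2 * d * (8 * d ^ 3 + 28 * d ^ 2 + 2 * d - 1) := largeForceCoeffZd_at_five d
  have e6 : CostSeries.e (costCoeffZd d) 6 = -(4 * d * (8 * d ^ 4 + 52 * d ^ 3 + 26 * d ^ 2 - 18 * d + 3)) := largeForceCoeffZd_at_six d
  have e7 : CostSeries.e (costCoeffZd d) 7 = 4 * d * (16 * d ^ 5 + 168 * d ^ 4 + 224 * d ^ 3 - 146 * d ^ 2 + 17 * d - 4) :=
    largeForceCoeffZd_at_seven d
  show CostSeries.e (costCoeffZd d) 8 = _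
  rw [CostSeries.e_eight_eq, aZd_one, aZd_two, aZd_three, aZd_four, aZd_five, aZd_six, aZd_seven, aZd_eight, e1, e2, e3, e4, e5, e6, e7]
  ring

/-- `c_8 = −4188` on `ℤ²`. [cite: JansevanRensburgWhittington2013, §3.2 Theorem 8 (arXiv v4 p. 11)] -/
theorem largeForceCoeff_eight_eq : largeForceCoeff 8 = -4188 := by
  rw [← largeForceCoeffZd_one 8, largeForceCoeffZd_at_eight]; norm_num

/-- ★★ **`e^{λ_B(y)}` on `ℤ^{d+1}` to order `y⁻⁷`**: the seventh-order expansion of `…ZdSeventhOrder` plus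
`−4d(32d⁶+496d⁵+1280d⁴−484d³−432d²+256d−101)/y⁷ + O(1/y⁸)`, every dimension. [cite: JansevanRensburgWhittington2013, §3.2 Theorem 8 (arXiv v4 p. 11)] -/
theorem exp_pulledBridgeFreeEnergy_eighth_order_zd (d : ℕ) :
    ∃ C y₁ : ℝ, 0 < y₁ ∧ ∀ y ≥ y₁,
      |Real.exp (pulledBridgeFreeEnergy (d + 1) y) -
        (y + 2 * d - 2 * d / y + 2 * d * (2 * d + 1) / y ^ 2 - 4 * d ^ 2 * (2 * d + 3) / y ^ 3 +
          2 * d * (8 * d ^ 3 + 28 * d ^ 2 + 2 * d - 1) / y ^ 4 - 4 * d * (8 * d ^ 4 + 52 * d ^ 3 + 26 * d ^ 2 - 18 * d + 3) / y ^ 5 +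
          4 * d * (16 * d ^ 5 + 168 * d ^ 4 + 224 * d ^ 3 - 146 * d ^ 2 + 17 * d - 4) / y ^ 6 -
          4 * d * (32 * d ^ 6 + 496 * d ^ 5 + 1280 * d ^ 4 - 484 * d ^ 3 - 432 * d ^ 2 + 256 * d - 101) / y ^ 7)| ≤
        C / y ^ 8 := by
  obtain ⟨C, y₁, hy₁, h⟩ := exp_pulledBridgeFreeEnergy_expansion_zd d 8
  refine ⟨C, y₁, hy₁, fun y hy => ?_⟩
  have hy0 : 0 < y := lt_of_lt_of_le hy₁ hy
  have h1 := h y hy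
  have hs : ∑ k ∈ Finset.range (8 + 1), y * ((largeForceCoeffZd d k : ℝ) * y⁻¹ ^ k) =
      y + 2 * d - 2 * d / y + 2 * d * (2 * d + 1) / y ^ 2 - 4 * d ^ 2 * (2 * d + 3) / y ^ 3 +
        2 * d * (8 * d ^ 3 + 28 * d ^ 2 + 2 * d - 1) / y ^ 4 - 4 * d * (8 * d ^ 4 + 52 * d ^ 3 + 26 * d ^ 2 - 18 * d + 3) / y ^ 5 +
        4 * d * (16 * d ^ 5 + 168 * d ^ 4 + 224 * d ^ 3 - 146 * d ^ 2 + 17 * d - 4) / y ^ 6 -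
        4 * d * (32 * d ^ 6 + 496 * d ^ 5 + 1280 * d ^ 4 - 484 * d ^ 3 - 432 * d ^ 2 + 256 * d - 101) / y ^ 7 := by
    rw [Finset.sum_range_succ, Finset.sum_range_succ, Finset.sum_range_succ, Finset.sum_range_succ, Finset.sum_range_succ,
      Finset.sum_range_succ, Finset.sum_range_succ, Finset.sum_range_succ, Finset.sum_range_one, largeForceCoeffZd_zero,
      largeForceCoeffZd_at_one, largeForceCoeffZd_at_two, largeForceCoeffZd_at_three, largeForceCoeffZd_at_four, largeForceCoeffZd_at_five,
      largeForceCoeffZd_at_six, largeForceCoeffZd_at_seven, largeForceCoeffZd_at_eight]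
    push_cast
    field_simp
    ring
  rwa [hs] at h1

end Literature.Probability.RandomPlanarGeometry.SAW.Zd

end
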